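import Literature.MathematicalPhysics.QuantumFieldTheory.Balaban1983to89.T3NestedUnitLaws
import Literature.MathematicalPhysics.QuantumFieldTheory.Balaban1983to89.T3UnitLawDensityEML
import Literature.MathematicalPhysics.QuantumFieldTheory.Balaban1983to89.T3DescentFibreTower
import Literature.MathematicalPhysics.QuantumFieldTheory.Balaban1983to89.BlockAveragingSectionPlaq
import Literature.MathematicalPhysics.QuantumFieldTheory.Balaban1983to89.T3LevelShift
import HarnessLib

/-!
# Crux `FluctuationComparisonRegPrIntL` (stmt-QuantumFields-20520, rung R3), LINE g25-1 «organ_tangent» — the SECTION binder of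
# ✓`OrganTangentTriangularChart.regularPackage_of_oneVariableInverseLaws` ((L5) v2, ✓p782575) DISCHARGED BY NAME:
# a continuous (hence measurable) GLOBAL right inverse of Bałaban's one-step `descend` at the printed smearing `ℰp`

LEAD-20520 width seat ym-ust-20520-w3 g22 (cell ym3-torus), `--supports stmt-QuantumFields-20520` (helper).  THEOREMS ONLY, def-free.

(L5) v2 displays, among the inputs of the spliced triangular chart, a SECTION of `descend F ℰp j` over the coarse window:
`(s : T_j → T_{j+1}) (hsm : Measurable s) (hs : ∀ V, PlaqSmall θ_j V → descend F ℰp j (s V) = V)`.  The tree already holds one for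
EVERY `V` (no window needed): the FACE SECTION `faceSec` of the (0.4) block averaging ([Balaban1987RG1] (0.4): the coarse bond variable on
every fine bond exiting its block, `1` elsewhere; ✓`BlockAveragingSection.blockAvg_faceSec` — exact right inverse of `blockAvg ℰ` for every
`ℰ` with `ℰ(1,…,1) = 1`, in particular `ℰp = expMeanLogSU` by ✓`T3DescentFibreTower.expMeanLogSU_E_one`), composed with the level
identification `fieldShift` of ✓`T3LevelShift` (`descend = fieldShift ∘ blockAvg₀`).  This file proves: `faceSec` is CONTINUOUS and
MEASURABLE (each coordinate is a coordinate projection or the constant `1`); ★`descend_faceSec_fieldShift : descend F ℰp j (faceSec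
(fieldShift h.symm V)) = V` for all `V`; the section maps `δ`-small fields to `δ`-small fields (gain `1`, ✓`plaqSmall_faceSec` +
✓`plaqHol_fieldShift`); and the ∃-package ★`exists_continuous_section_descend` in exactly the shape (L5) v2 consumes
(`s := fun V => faceSec (fieldShift (sitesPerDir_descend F j 0).symm V)`).  (The crux workfile `Lines/organ_twisted_fibre.lean` has the same
right-inverse computation under a `def sliceLift`; Cruxes files are not importable — this is the def-free Theorems form.)

HONEST FRAMING: folklore about an explicit section; nothing of Bałaban's analysis is asserted or proved; the chart laws, (C3), (A), COAREA∘,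
VER∘, O1, crux 20520, `YM3TorusSU2` are NOT proved; registry `Lines/semiclassical_s2beta.lean` v11.4 (★★OWNER RULING №36) untouched; rung
R3 = SU(2) YM₃ on T³ — NOT d = 4, NOT infinite volume, NOT a mass gap, NOT Clay; the Yang–Mills mass gap is NOT proved by any of this.
-/

set_option autoImplicit false

noncomputable section

namespace Summit.QuantumFields.YangMills.Theorems.OrganTangentDescendSection

open MeasureTheory Filter Topology Set
open Literature.MathematicalPhysics.QuantumFieldTheory.Balaban1983to89
open T4Continuum T3ContinuumYM3Torus T3NestedUnitLaws T3UnitLawDensityEML T3LevelShift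
open Literature.MathematicalPhysics.QuantumFieldTheory.Balaban1983to89.BlockAveragingSection (faceSec ExitsBlock blockAvg_faceSec)
open Literature.MathematicalPhysics.QuantumFieldTheory.Balaban1983to89.BlockAveragingSectionPlaq (plaqSmall_faceSec)
open Literature.MathematicalPhysics.QuantumFieldTheory.Balaban1983to89.T3DescentFibreTower (expMeanLogSU_E_one)

/-! ## §1 The face section is continuous and measurable (any group) -/

section FaceSec

variable {P : Params} {j : ℕ} {G : Type*} [GaugeGroup G]

/-- `faceSec` is continuous: every coordinate is a coordinate projection or the constant `1` [folklore].
[cite: Balaban1987RG1, (0.4) p.253] -/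
theorem continuous_faceSec [TopologicalSpace G] : Continuous (faceSec : GaugeField P (j + 1) G → GaugeField P j G) := by
  refine continuous_pi fun b => ?_
  by_cases h : ExitsBlock b
  · simp only [faceSec, h, if_true]
    exact continuous_apply _
  · simp only [faceSec, h, if_false]
    exact continuous_const

/-- `faceSec` is measurable for the product σ-algebras [folklore]. [cite: Balaban1985Averaging, (10) p.19] -/
theorem measurable_faceSec [MeasurableSpace G] : Measurable (faceSec : GaugeField P (j + 1) G → GaugeField P j G) := by
  refine measurable_pi_lambda _ fun b => ?_
  by_cases h : ExitsBlock b
  · simp only [faceSec, h, if_true]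
    exact measurable_pi_apply _
  · simp only [faceSec, h, if_false]
    exact measurable_const

omit [GaugeGroup G] in
/-- `fieldShift h` is continuous (a reindexing of coordinates) [folklore]. [cite: Balaban1987RG1, (0.1) p.251] -/
theorem continuous_fieldShift [TopologicalSpace G] {F : T3Family} {m K k m' K' k' : ℕ}
    (h : (F.PP m K).sitesPerDir k = (F.PP m' K').sitesPerDir k') :
    Continuous (fieldShift h : GaugeField (F.PP m' K') k' G → GaugeField (F.PP m K) k G) :=
  continuous_pi fun _ => continuous_apply _

end FaceSec

/-! ## §2 A global continuous section of `descend F ℰp j` -/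

section Descend

variable (F : T3Family) (j : ℕ)

/-- ★ **THE FACE SECTION INVERTS `descend` EVERYWHERE**: `descend F ℰp j (faceSec (fieldShift h.symm V)) = V` for every coarse `V`
(`h := sitesPerDir_descend F j 0`; ✓`blockAvg_faceSec` at `ℰp` by ✓`expMeanLogSU_E_one`, then ✓`fieldShift_symm_fieldShift`).
[cite: Balaban1987RG1, (0.4) p.253] -/
theorem descend_faceSec_fieldShift (V : GaugeField (F.P j) 0 ↥(Matrix.specialUnitaryGroup (Fin 2) ℂ)) :
    descend F ℰp j (faceSec (fieldShift (sitesPerDir_descend F j 0).symm V)) = V := by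
  have hj : 0 + 1 ≤ (F.P (j + 1)).m + (F.P (j + 1)).K := by show 0 + 1 ≤ F.m + (j + 1); omega
  exact (congrArg (fieldShift (sitesPerDir_descend F j 0))
    (blockAvg_faceSec hj ℰp expMeanLogSU_E_one (fieldShift (sitesPerDir_descend F j 0).symm V))).trans
    (fieldShift_symm_fieldShift _ V)

/-- The section is continuous. [cite: Balaban1987RG1, (0.4) p.253] -/
theorem continuous_section :
    Continuous (fun V : GaugeField (F.P j) 0 ↥(Matrix.specialUnitaryGroup (Fin 2) ℂ) =>
      (faceSec (fieldShift (sitesPerDir_descend F j 0).symm V) :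
        GaugeField (F.P (j + 1)) 0 ↥(Matrix.specialUnitaryGroup (Fin 2) ℂ))) :=
  continuous_faceSec.comp (continuous_fieldShift _)

/-- The section is measurable. [cite: Balaban1985Averaging, (10) p.19] -/
theorem measurable_section :
    Measurable (fun V : GaugeField (F.P j) 0 ↥(Matrix.specialUnitaryGroup (Fin 2) ℂ) =>
      (faceSec (fieldShift (sitesPerDir_descend F j 0).symm V) :
        GaugeField (F.P (j + 1)) 0 ↥(Matrix.specialUnitaryGroup (Fin 2) ℂ))) :=
  measurable_faceSec.comp (measurable_fieldShift _)

/-- The section has GAIN `1` on small fields: a `δ`-small coarse field (`δ > 0`) lifts to a `δ`-small fine field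
(✓`plaqSmall_faceSec` + ✓`plaqHol_fieldShift`). [cite: Balaban1987RG1, (0.18) p.255] -/
theorem plaqSmall_section {δ : ℝ} (hδ : 0 < δ) (V : GaugeField (F.P j) 0 ↥(Matrix.specialUnitaryGroup (Fin 2) ℂ))
    (hV : PlaqSmall δ V) :
    PlaqSmall δ (faceSec (fieldShift (sitesPerDir_descend F j 0).symm V) :
      GaugeField (F.P (j + 1)) 0 ↥(Matrix.specialUnitaryGroup (Fin 2) ℂ)) := by
  have hj : 0 + 1 ≤ (F.P (j + 1)).m + (F.P (j + 1)).K := by show 0 + 1 ≤ F.m + (j + 1); omega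
  have hW : PlaqSmall δ (fieldShift (sitesPerDir_descend F j 0).symm V) := fun p => by
    rw [plaqHol_fieldShift]; exact hV _
  exact plaqSmall_faceSec hj hδ hW

/-- ★ **∃-PACKAGE — the SECTION binder of (L5) v2 discharged**: a continuous, measurable, global right inverse of `descend F ℰp j`
with gain `1` on small fields; in particular `(s, hsm, hs)` of ✓`OrganTangentTriangularChart.regularPackage_of_oneVariableInverseLaws`
(whose `hs` asks the identity on the window only). [cite: Balaban1987RG1, (0.4) p.253] -/
theorem exists_continuous_section_descend :
    ∃ s : GaugeField (F.P j) 0 ↥(Matrix.specialUnitaryGroup (Fin 2) ℂ) →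
        GaugeField (F.P (j + 1)) 0 ↥(Matrix.specialUnitaryGroup (Fin 2) ℂ),
      Continuous s ∧ Measurable s ∧ (∀ V, descend F ℰp j (s V) = V) ∧
        ∀ (δ : ℝ), 0 < δ → ∀ V, PlaqSmall δ V → PlaqSmall δ (s V) :=
  ⟨fun V => faceSec (fieldShift (sitesPerDir_descend F j 0).symm V), continuous_section F j, measurable_section F j,
    descend_faceSec_fieldShift F j, fun _ hδ V hV => plaqSmall_section F j hδ V hV⟩

end Descend

end Summit.QuantumFields.YangMills.Theorems.OrganTangentDescendSection

end
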